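import Summits.HodgeConjecture.HodgeConjecture.Theorems.EndoscopicMiddleDegreeOrthogonalEnvelopedHeckeGraphChow
import Summits.HodgeConjecture.HodgeConjecture.Theorems.EndoscopicMiddleDegreeOrthogonalEnvelopedTransferFundamentalClass
import Summits.HodgeConjecture.HodgeConjecture.Theorems.EndoscopicMiddleDegreeOrthogonalEnvelopedTopCorrAction
import Summits.HodgeConjecture.HodgeConjecture.Theorems.EndoscopicMiddleDegreeOrthogonalEnvelopedVanishesOffImage
import Summits.HodgeConjecture.HodgeConjecture.Theorems.EndoscopicMiddleDegreeOrthogonalEnvelopedHeckeGraphAnalyticOfStubs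
import Summits.HodgeConjecture.HodgeConjecture.Theorems.EndoscopicMiddleDegreeOrthogonalEnvelopedHeckeImageModelAnalytic
import Summits.HodgeConjecture.HodgeConjecture.Theorems.EndoscopicMiddleDegreeOrthogonalEnvelopedUnifHolomorphic
import Summits.HodgeConjecture.HodgeConjecture.Theorems.EndoscopicMiddleDegreeOrthogonalEnvelopedUnifSliceSection
import Summits.HodgeConjecture.HodgeConjecture.Theorems.EndoscopicMiddleDegreeOrthogonalEnvelopedSectionHolomorphicOfInjOn
import Summits.HodgeConjecture.HodgeConjecture.Theorems.EndoscopicMiddleDegreeOrthogonalEnvelopedGraphOnRegular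
import Summits.HodgeConjecture.HodgeConjecture.Theorems.EndoscopicMiddleDegreeOrthogonalEnvelopedRegularPointOfFiniteUnion
import Summits.HodgeConjecture.HodgeConjecture.Theorems.EndoscopicMiddleDegreeOrthogonalEnvelopedSymmHolomorphicOfHomeomorph
import Summits.HodgeConjecture.HodgeConjecture.Theorems.EndoscopicMiddleDegreeOrthogonalEnvelopedHodgeModelProdBiholomorph
import Summits.HodgeConjecture.HodgeConjecture.Theorems.EndoscopicMiddleDegreeOrthogonalEnvelopedProperlyDiscontinuousOfBricks
import Summits.HodgeConjecture.HodgeConjecture.Theorems.EndoscopicMiddleDegreeOrthogonalEnvelopedCongruenceBoundedFinite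
import Summits.HodgeConjecture.HodgeConjecture.Theorems.EndoscopicMiddleDegreeOrthogonalEnvelopedArchimedeanBoundOfBricks
import Summits.HodgeConjecture.HodgeConjecture.Theorems.EndoscopicMiddleDegreeOrthogonalEnvelopedDefiniteUnitaryBounded
import Summits.HodgeConjecture.HodgeConjecture.Theorems.EndoscopicMiddleDegreeOrthogonalEnvelopedSylvesterEntryBound
import Summits.HodgeConjecture.HodgeConjecture.Theorems.EndoscopicMiddleDegreeOrthogonalEnvelopedIndefiniteUnitaryEntryBound
import Summits.HodgeConjecture.HodgeConjecture.Theorems.EndoscopicMiddleDegreeOrthogonalEnvelopedCornerBound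
import Summits.HodgeConjecture.HodgeConjecture.Theorems.EndoscopicMiddleDegreeOrthogonalEnvelopedFreeAction
import Summits.HodgeConjecture.HodgeConjecture.Theorems.EndoscopicMiddleDegreeOrthogonalEnvelopedBallTopology

/-!
# Stub `stub_heckeGraphAlgebraic` of line `core-splitting-ladder` (crux `EndoscopicMiddleDegree.AlgebraicOrEnveloped`,
# stmt-HodgeConjecture-14943): the Hecke operators are actions of ALGEBRAIC self-correspondences

For an orientation family `μ` with Poincaré duality, `m ∈ {1,2}`, a compact unitary ball quotient datum
`D : UnitaryBallQuotientDatum (2(m+1)) X` and any `g`, the Hecke operator `T_g` on `H^{2(m+1)}(X(ℂ); ℂ)` is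
the correspondence action `corrAction μ … γ` of an algebraic class `γ ∈ N^{2(m+1)} H^{4(m+1)}((X ⊗ X)(ℂ); ℂ)`
(BMM arXiv:1306.1515 Part 2 §1.8 / Thm. 61; Shimura Ch. 7 §7.2).

This file is pure COMPOSITION of landed theorems of the sibling crux `OrthogonalEnveloped` (stmt-HodgeConjecture-14300),
all `--supports` of that item and sorry-free:

* the Chow/analytic-support reduction `heckeGraphAlgebraic_of_inputs` (p107344) with its inputs
  S0 `stub_transferFundamentalClass` (p106716), T3 `stub_topCorrAction` (p107091), S2a `stub_vanishesOffImage` (p106705);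
* S2b (the Hecke graph read in any Hodge model of `X ⊗ X` is a closed analytic subset all of whose regular points have
  codimension `≥ 2(m+1)`), assembled here (`heckeGraphAnalytic`) exactly as in the registered skeleton of stmt-14300
  (rev c3-L1, `heckeGraphAnalytic_assembled`) from `stub_heckeGraphAnalyticOfStubs` (p111259) fed with
  `stub_heckeImageModelAnalytic` (p111206) ∘ (B `stub_unifHolomorphic` p110764, A1 `stub_unifSliceSection` p110875,
  A2 `stub_sectionHolomorphicOfInjOn` p110878, C `stub_graphOnRegular` p110690, D `stub_regularPointOfFiniteUnion` p110844),
  E2 `stub_hodgeModelProdBiholomorph` (p110858) ∘ O `stub_symmHolomorphicOfHomeomorph` (p110775), freeness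
  `stub_freeOfProperlyDiscontinuous` (p107635), ball topology `stub_ballLocallyCompactT2` (p107937), and
* G1 (`Γ` acts properly discontinuously on the ball), assembled here (`properlyDiscontinuousSMul_ball`) from
  `stub_properlyDiscontinuousOfBricks` (p108067) ∘ (`stub_congruenceBoundedFinite` p108331,
  `stub_archimedeanBoundOfBricks` p108471 ∘ (`stub_definiteUnitaryBounded` p108224, `stub_sylvesterEntryBound` p108321 ∘
  `stub_indefiniteUnitaryEntryBound` p107948, `stub_cornerBound` p108918)).

No hypothesis, no new mathematics: the statement is byte-identical with the registered stub of the skeleton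
`Cruxes/AlgebraicOrEnveloped/Lines/core_splitting_ladder.lean` and with the conclusion of `heckeGraphAlgebraic_of_inputs`.

References: N. Bergeron, J. Millson, C. Moeglin, *Hodge type theorems for arithmetic manifolds associated to
orthogonal groups* / the ball-quotient companion arXiv:1306.1515, Part 2 §1.4, §1.8, Thm. 61; G. Shimura,
*Introduction to the arithmetic theory of automorphic functions* (1971), Ch. 7 §7.2; J.-P. Serre, GAGA (1956) §19.
-/

noncomputable section

-- The mandated namespace `Summit.<P>.<Sub>.Theorems.…` repeats `HodgeConjecture` (single-conjunct summit).
set_option linter.dupNamespace false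

namespace Summit.HodgeConjecture.HodgeConjecture.Theorems.CoreSplittingLadder

open scoped Manifold
open CategoryTheory MonoidalCategory CartesianMonoidalCategory
open Literature.AlgebraicGeometry.Motives (SchemeOver ComplexPoints IsSmoothProjective AlgPoints)
open Literature.AlgebraicGeometry.HodgeTheory
open Literature.AlgebraicGeometry.ShimuraVarieties
open Literature.AlgebraicTopology.SingularHomology
open Literature.Geometry.Kaehler (IsAnalyticSet IsAnalyticSetAt regularLocus IsRegularPointOfCodim)
open Summit.HodgeConjecture.HodgeConjecture.Cruxes.OrthogonalEnveloped.HeckeGraphChow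
open Summit.HodgeConjecture.HodgeConjecture.Theorems.EndoscopicMiddleDegreeOrthogonalEnvelopedHeckeGraphChow
  (heckeGraphAlgebraic_of_inputs)

/-- **G1 — `Γ` acts properly discontinuously on the ball** (assembly of the landed bricks: discreteness of the
congruence subgroup + archimedean boundedness of contact elements at every complex place).
[cite: BergeronMillsonMoeglin2016Balls, Part 2 §1.4] -/
theorem properlyDiscontinuousSMul_ball :
    ∀ {p : ℕ} {X : SchemeOver ℂ} (D : UnitaryBallQuotientDatum p X),
      ProperlyDiscontinuousSMul ↥D.Γ D.ball :=
  stub_properlyDiscontinuousOfBricks stub_congruenceBoundedFinite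
    (stub_archimedeanBoundOfBricks stub_definiteUnitaryBounded
      (stub_sylvesterEntryBound stub_indefiniteUnitaryEntryBound) stub_cornerBound)

/-- **S2b — the Hecke graph of an admissible `g`, read in ANY Hodge model of `X ⊗ X`, is a closed analytic subset
all of whose regular points have codimension `≥ 2(m+1) = dim X`** (assembly, verbatim the registered skeleton's
`heckeGraphAnalytic_assembled` of stmt-HodgeConjecture-14300 with every sub-stub replaced by its landed theorem).
[cite: BergeronMillsonMoeglin2016Balls, Part 2 §1.8] [cite: Shimura1973, Ch. 7 §7.2] -/
theorem heckeGraphAnalytic :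
    ∀ (m : ℕ) (X : SchemeOver ℂ) (D : UnitaryBallQuotientDatum (2 * (m + 1)) X), 1 ≤ m → m ≤ 2 →
      ∀ (g : GL (Fin (2 * (m + 1) + 1)) D.E) (h : D.IsHeckeAdmissible g)
        (A : HodgeModel (2 * (m + 1) + 2 * (m + 1)) (X ⊗ X)),
        IsAnalyticSet 𝓘(ℂ, A.model)
            (A.toComplexPoints ⁻¹' Set.range (fun ℓ : D.LevelCover (D.heckeLevel g) ↦
              (AlgPoints.prodEquiv (X := X) (Y := X) (L := ℂ)).symm
                (D.levelProj (D.heckeLevel g) ℓ, UnitaryBallQuotientDatum.IsHeckeAdmissible.twist D h ℓ))) ∧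
          ∀ x ∈ regularLocus 𝓘(ℂ, A.model)
              (A.toComplexPoints ⁻¹' Set.range (fun ℓ : D.LevelCover (D.heckeLevel g) ↦
                (AlgPoints.prodEquiv (X := X) (Y := X) (L := ℂ)).symm
                  (D.levelProj (D.heckeLevel g) ℓ, UnitaryBallQuotientDatum.IsHeckeAdmissible.twist D h ℓ))),
            ∀ q : ℕ, IsRegularPointOfCodim 𝓘(ℂ, A.model)
              (A.toComplexPoints ⁻¹' Set.range (fun ℓ : D.LevelCover (D.heckeLevel g) ↦
                (AlgPoints.prodEquiv (X := X) (Y := X) (L := ℂ)).symm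
                  (D.levelProj (D.heckeLevel g) ℓ, UnitaryBallQuotientDatum.IsHeckeAdmissible.twist D h ℓ))) q x →
              2 * (m + 1) ≤ q :=
  stub_heckeGraphAnalyticOfStubs
    (stub_heckeImageModelAnalytic stub_unifHolomorphic stub_unifSliceSection stub_sectionHolomorphicOfInjOn
      stub_graphOnRegular stub_regularPointOfFiniteUnion)
    (stub_hodgeModelProdBiholomorph stub_symmHolomorphicOfHomeomorph)
    properlyDiscontinuousSMul_ball stub_freeOfProperlyDiscontinuous stub_ballLocallyCompactT2

/-- **Stub 3 of line `core-splitting-ladder` — the Hecke operators are actions of ALGEBRAIC self-correspondences**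
(KNOWN: BMM arXiv:1306.1515 Part 2 §1.8 / Thm. 61, Shimura Ch. 7 §7.2): for `μ` with Poincaré duality, `m ∈ {1,2}`,
a datum `D` and any `g`, `T_g = P_γ` for some `γ ∈ N^{2(m+1)} H^{4(m+1)}((X ⊗ X)(ℂ); ℂ)` — the landed Chow / analytic
support composition `heckeGraphAlgebraic_of_inputs` fed with the landed S0, T3, S2a and the assembled S2b.
[cite: BergeronMillsonMoeglin2016Balls, Part 2 §1.8 and Thm. 61] [cite: Shimura1973, Ch. 7 §7.2] -/
theorem stub_heckeGraphAlgebraic :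
    ∀ (μ : OrientationFamily), μ.HasPoincareDuality →
      ∀ (m : ℕ) (X : SchemeOver ℂ) (D : UnitaryBallQuotientDatum (2 * (m + 1)) X), 1 ≤ m → m ≤ 2 →
        ∀ g : GL (Fin (2 * (m + 1) + 1)) D.E,
          ∃ γ ∈ algebraicClasses (X ⊗ X) (2 * (m + 1)),
            corrAction μ D.isSmoothProjective D.isSmoothProjective
                (rfl : 2 * (m + 1) + 2 * (2 * (m + 1)) = 2 * (m + 1) + 2 * (2 * (m + 1))) γ =
              D.heckeCorrespondenceAction (2 * (m + 1)) g :=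
  heckeGraphAlgebraic_of_inputs stub_transferFundamentalClass stub_topCorrAction stub_vanishesOffImage
    heckeGraphAnalytic

end Summit.HodgeConjecture.HodgeConjecture.Theorems.CoreSplittingLadder

end
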